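import Summits.QuantumFields.BalabanUV.T4Continuum.Support.NE9Lemma1RemainderSpecies
import Summits.QuantumFields.BalabanUV.T4Continuum.Support.NE9Lemma1CurveRemainder

/-!
# NE9Lemma1CurveSpecies — LOCATED CORRECTION O-ne9p1g25-1, part 2 of 3: the DISPLAYED species of [II] §1 re-typed with ANALYTIC
# SLICE CURVES (Lemma 4 (3.53) of [I]) in place of rays; leaf S5's per-piece bound `PieceBoundOnG` PROVED on the analytic class
# for curve data; the ray species of parts 2–5 (`RemData`) is LITERALLY the special case γ(σ′) = σ′•A (`RemData.toCur_toC`, rfl)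
# (cell `pub-balaban`, T4-DAG §2 node U3 / §6 NE9; lineage t4-ne9-p1 = row NE9 OWNER, generation 25)

v1.0.1 DOCFIX (docstrings only, declarations byte-unchanged): the slice curves are parametrised σ′ ↦ U_j(□₀, exp iσ′B)|_X,
centred at the expansion point σ′ = 0 and read at σ′ = 1 (v1 wrote «exp i(B + σ′B)» in three glosses).

HONEST FRAMING (T4-DAG PAGE 1).  Rung (B)+1 of the FINITE-VOLUME T⁴ programme — NOT infinite volume, NOT a mass gap, NOT the
Clay problem.  NE9 (`T4OutputRate.NE9` ∧ `FadingMemory`) is a cell NEW ESTIMATE, NOT PRINTED, NOT discharged here; spine 0/9.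
HONEST DEPENDENCY (cell line, verbatim): continuum YM on T⁴ ⇐ BetaPertH ∧ nine spine estimates (0/9 proved); BetaPertH ⇐ (D1)
∧ (D4) ∧ CAP+tail; G-an2-4 gates asym, D1 and NE2/3/4.  `FlowStep.BetaPertH`, (B), (B^μ) do not occur.  [I] = [Balaban1987RG1]
(CMP **109**), [II] = [Balaban1988RG2Cluster] (CMP **116**) are quoted for TYPES only (ABSOLUTE RULE: nothing printed in the
audited series is asserted).

WHERE THIS SITS (skeleton `t4/b2b-balaban-t4-ne9-p1/SKELETON-NE9-P1.md` §3 row S5, §4 O-NE9-1, O-NE9-2; part 1 = `NE9Lemma1CurveRemainder`,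
which carries the located correction in full: [I] (3.34)/(3.54) expand and bound the old term along σ ↦ U_j(□₀, exp iσB)|_X,
an analytic CURVE in U^c_j(X) — (3.37) p. 277, (3.30) p. 276: the background map is a minimizer composed with the group law,
linear only for abelian G — so the ray datum `RemData.dir` of v1.3.5 is uninstantiable on Bałaban's (1.23)-pieces for SU(2)).
THIS FILE re-types the species and re-proves its S5 leaf for the corrected shape:
* §1 the datum **`CurData`** (= `RemData` with the directions `dir`/`dirB` replaced by the SLICE CURVES `cur … t s σ : ℂ → E` and
  the slice radii `ϱ` ↔ α₃/|B|), its piece form `CurData.toC : CPieceData` (piece at (X, re/im) := Re/Im `curPiece e^{κ₁} r_k cubes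
  (lift H X) 5 cur s₀ σ₀`), `PieceZero`/`PieceLocal`/`CSrcScale` PROVED;
* §2 the binder structure **`CurData.Admissible`** — κ₁ ≥ 1; r_k > 0; R_X > 0; ON THE CONTOURS every slice curve is analytic on
  `|σ′| < ϱ` and maps that disc into the analyticity ball of its source ([I] Lemma 4 (3.53) p. 280 — the DOMAIN INCLUSION, printed
  TYPE, displayed); `ϱ > 1`; the GAIN `ϱ⁻¹ ≤ c_dir·ℓ k j` ((3.54) p. 280 *"|B| < α₁L^jη"*, `c_dir ↔ α₁/α₃`); source discipline;
  G1; `c_dir ≥ 0` — and **`pieceBoundOnG_cur`**: `PieceBoundOnG (analyticClass R) D.toC κ κ₁ d₀ (Kp k = 64·c_dir⁵/r_k) (ℓ⁵)`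
  PROVED (`norm_curPiece_le` + `B13Sect1Arith.bound_125`); **`channelSizeAtStepNN_cur`** = leaf S5 for the curve species on the
  analytic class (part 1 of gen 24 `channelSizeAtStepNN_cpieceG` BY NAME); `structureBinders_cur`; `channelAdditive_cur_of_pieceAdditive`;
* §3 the ray species IS the special case: `RemData.toCur` (cur := σ′•dir, ϱ := R_X/dirB), **`RemData.toCur_toC : D.toCur.toC =
  D.toC`** (`rfl` — parts 2–3 of gen 24 and the crew's (w16)/A3-REM/MP-REM/E5′-REM modules are statements about this sub-case,
  all still correct), `RemData.Admissible.toCur` (under `0 < dirB`), and part 2's per-piece bound recovered from the curve bound.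
WHAT REMAINS DISPLAYED for the species: O1 (Bałaban's pieces ARE `CurData.toC` of his (1.23) data — the curve at (k, □₀, Y₀, X;
t, s, σ) being σ′ ↦ the chart of `U_j(□₀, exp iσ′B)|_X` (expansion point σ′ = 0 ↔ U_j(□₀, 1), evaluated at σ′ = 1, analytic on
|σ′| < α₃/|B| by Lemma 4 (3.53) with τ = 0, B′ = σ′B), B = B(t, s, σ) of [II] (1.1)/(1.23)), `CurData.Admissible`
(Lemma 4 TYPE + gain letter + radii + G1), the level counts, additivity on curves ((w16)'s twin — crew), and the TYPE
simplification already made in v1.3 (U^c_j(X, α₀, α₁) read as a ball of a normed chart).  DISGUISE TEST: one input family, one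
history; a size bound, not NE9.

References (TYPES only): [Balaban1987RG1] T. Bałaban, CMP **109** (1987) 249–301, (3.28)–(3.30) p. 276, (3.33)–(3.37) p. 277,
Lemma 4 (3.53)–(3.54) p. 280; [Balaban1988RG2Cluster] T. Bałaban, CMP **116** (1988) 1–22, (1.1) p. 3, (1.22)–(1.29) pp. 7–8,
(1.36) p. 9.  Summits-side NEW work (LEAN PLACEMENT RULE); imports gen 24's `NE9Lemma1RemainderSpecies` and part 1 BY NAME;
modifies nothing; 0 sorry.  Value = the species' S5 leaf re-proved for the corrected datum shape, NOT summit progress.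
-/

noncomputable section

namespace Summit.QuantumFields.BalabanUV.T4Continuum.NE9Lemma1CurveSpecies

open scoped BigOperators
open Metric Set Complex
open Literature.MathematicalPhysics.QuantumFieldTheory.Balaban1983to89
open Literature.MathematicalPhysics.QuantumFieldTheory.Balaban1983to89.T4OutputRate
open Literature.MathematicalPhysics.QuantumFieldTheory.Balaban1983to89.T4HistoryLipschitzRecursion
open Summit.QuantumFields.BalabanUV.T4Continuum.NE9Lemma1Counting
open Summit.QuantumFields.BalabanUV.T4Continuum.NE9Lemma1Gain
open Summit.QuantumFields.BalabanUV.T4Continuum.NE9Lemma1PieceClass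
open Summit.QuantumFields.BalabanUV.T4Continuum.NE9Lemma1RemainderPiece
open Summit.QuantumFields.BalabanUV.T4Continuum.NE9Lemma1RemainderSpecies
open Summit.QuantumFields.BalabanUV.T4Continuum.NE9Lemma1CurveRemainder
open Summit.QuantumFields.BalabanUV.T4Continuum.NE9ComplexEncoding (doubleCarriers)

/-! ## §1 The curve species: datum and piece form -/

section Species

variable {C : Carriers} {E : Type} {ι α β γ δ : Type}

/-- **THE DATUM OF THE CURVE SPECIES** at FORM level: as `RemData` (index families on the doubled carriers, κ₁, the t_□-radii
`r k` of (1.22), the cubes Δ ⊂ Y₀∖□̃⁴, the analyticity radii `R X`), with the contour directions replaced by the SLICE CURVES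
`cur … t s σ : ℂ → E` (↔ σ′ ↦ the chart of `U_j(□₀, exp iσ′B)|_X` — centred at σ′ = 0, read by the remainder at σ′ = 1 —, B = B(t, s, σ)
the field of [II] (1.1)/(1.23) built on
`(tζ̃_□ + t_□ζ_□)𝐇_k(σ(Y₀), B′)`; [I] (3.28)/(3.30), Lemma 4 (3.53)) and the slice radii `ϱ` (↔ α₃/|B|).  No inequality inside.
[cite: Balaban1987RG1, (3.53) p.280; Balaban1988RG2Cluster, (1.22)-(1.23) p.7] -/
structure CurData (C : Carriers) (E : Type) (ι α β γ δ : Type) where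
  /-- boxes □₀ ⊂ Y -/
  S0 : ℕ → ι → Finset α
  /-- connected domains Y₀ ∋ □̃⁴ -/
  SY : ℕ → ι → α → Finset β
  /-- sources (X, re/im), X ∈ 𝐃_j, X ⊂ □̃² -/
  src : ℕ → ι → α → ℕ → Finset (doubleCarriers C).Dom
  /-- counting cubes □′ -/
  Sq : ℕ → ι → α → ℕ → Finset γ
  /-- fibres X ⊃ □′ -/
  SX : ℕ → ι → α → ℕ → γ → Finset (doubleCarriers C).Dom
  /-- d_k(Y) -/
  dY : ℕ → ι → ℝ
  /-- κ₁ -/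
  κ₁ : ℝ
  /-- t_□-radius r_k -/
  r : ℕ → ℝ
  /-- the cubes Δ ⊂ Y₀ ∖ □̃⁴ -/
  cubes : ℕ → ι → α → β → List δ
  /-- slice curves σ′ ↦ U_j(□₀, exp iσ′B)|_X (σ′ = 0: expansion point; σ′ = 1: evaluation) at the contour point (t, s, σ) -/
  cur : ℕ → (ℕ → ℝ) → ι → α → β → (doubleCarriers C).Dom → ℂ → (δ → ℝ) → (δ → ℂ) → ℂ → E
  /-- analyticity radius R_X -/
  R : C.Dom → ℝ
  /-- slice radius ϱ (↔ α₃/|B|) -/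
  ϱ : ℕ → (ℕ → ℝ) → ι → α → β → (doubleCarriers C).Dom → ℝ

variable [DecidableEq δ]

/-- **THE PIECE FORM OF THE CURVE SPECIES**: volumes = number of cubes; piece at the source (X, re/im) := Re/Im of the
(1.23)-functional `curPiece e^{κ₁} r_k cubes (lift H X) 5 cur s₀ σ₀` of the FIFTH-ORDER Taylor remainder of the complex old term
along the slice curves. [cite: Balaban1988RG2Cluster, (1.23) p.7] -/
def CurData.toC (D : CurData C E ι α β γ δ) : CPieceData (doubleCarriers C) E ι α β γ where
  S0 := D.S0
  SY := D.SY
  src := D.src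
  Sq := D.Sq
  SX := D.SX
  vol := fun k y a b => ((D.cubes k y a b).length : ℝ)
  dY := D.dY
  piece := fun k s y a b x H => reIm x.2
    (curPiece (Real.exp D.κ₁) (D.r k) (D.cubes k y a b) (lift H x.1) 5 (D.cur k s y a b x)
      (fun _ => (0:ℝ)) (fun _ => ((Real.exp D.κ₁ : ℝ) : ℂ)))

/-- **`PieceZero` FOR THE CURVE SPECIES.** [folklore] -/
theorem pieceZero_cur (D : CurData C E ι α β γ δ) : PieceZero D.toC := by
  intro k s y a b x
  show reIm x.2 (curPiece _ _ _ (lift (0 : E → (doubleCarriers C).Dom → ℝ) x.1) 5 _ _ _) = 0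
  rw [lift_zero, curPiece_zero, reIm_zero]

/-- **`PieceLocal` FOR THE CURVE SPECIES**: the piece sourced at (X, ·) reads the family on the two copies of X only. [folklore] -/
theorem pieceLocal_cur (D : CurData C E ι α β γ δ) : PieceLocal D.toC := by
  intro k s y a b x H H' hHH'
  show reIm x.2 (curPiece _ _ _ (lift H x.1) 5 _ _ _) = reIm x.2 (curPiece _ _ _ (lift H' x.1) 5 _ _ _)
  rw [lift_congr hHH']

/-! ## §2 The binders and the per-piece bound PROVED on the analytic class -/

variable [NormedAddCommGroup E] [NormedSpace ℂ E]

/-- **THE BINDERS OF THE CURVE SPECIES** (printed TYPE statements and bookkeeping, displayed — NOT proved here): `κ₁ ≥ 1`;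
`r_k > 0`; `R_X > 0`; ON THE CONTOURS every slice curve is analytic on the disc `|σ′| < ϱ` and maps it into the analyticity ball
of its source — [I] Lemma 4 (3.53) p. 280 *"(U_j(□₀, exp i(τB + B′)), J_j(□₀, exp i(τB + B′)))|_X ∈ U^c_j(X, α₀, α₁)"* for
`|B′| < α₃`, *"The functions in (3.53) are analytic on the above spaces"* (the DOMAIN INCLUSION, with `ϱ ↔ α₃/|B|`); `ϱ > 1`
(`|B| < α₃`); the GAIN `ϱ⁻¹ ≤ c_dir·ℓ k j` ((3.54)–(3.55) p. 280: *"|B| < α₁L^jη"*, `c_dir ↔ α₁/α₃`, `ℓ k j ↔ L^jη`); the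
SOURCE DISCIPLINE; G1 ([II] (1.25) p. 7); `c_dir ≥ 0`.
[cite: Balaban1987RG1, (3.53)-(3.54) p.280; Balaban1988RG2Cluster, (1.25) p.7] -/
structure CurData.Admissible (D : CurData C E ι α β γ δ) (ℓ : ℕ → ℕ → ℝ) (cdir d0 : ℝ) : Prop where
  κ₁_ge : 1 ≤ D.κ₁
  r_pos : ∀ k, 0 < D.r k
  R_pos : ∀ X, 0 < D.R X
  cur_an : ∀ k s y a b x, ∀ t ∈ sphere (0:ℂ) (D.r k), ∀ s' σ',
    OnContour D.κ₁ (D.cubes k y a b) s' σ' →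
      DifferentiableOn ℂ (D.cur k s y a b x t s' σ') (ball 0 (D.ϱ k s y a b x)) ∧
        MapsTo (D.cur k s y a b x t s' σ') (ball 0 (D.ϱ k s y a b x)) (ball 0 (D.R x.1))
  ϱ_gt : ∀ k s y a b x, 1 < D.ϱ k s y a b x
  ϱ_inv_le : ∀ k s y, ∀ a ∈ D.S0 k y, ∀ b ∈ D.SY k y a, ∀ j, ∀ x ∈ D.src k y a j,
    (D.ϱ k s y a b x)⁻¹ ≤ cdir * ℓ k j
  srcScale : ∀ k y a j, ∀ x ∈ D.src k y a j, C.scale x.1 = j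
  G1 : ∀ k y, ∀ a ∈ D.S0 k y, ∀ b ∈ D.SY k y a, D.dY k y ≤ d0 + 4 * ((D.cubes k y a b).length : ℝ)
  d0_nonneg : 0 ≤ d0
  cdir_nonneg : 0 ≤ cdir

/-- The source discipline of the datum is part 1's `CSrcScale`. [folklore] -/
theorem csrcScale_cur {D : CurData C E ι α β γ δ} {ℓ : ℕ → ℕ → ℝ} {cdir d0 : ℝ} (hD : D.Admissible ℓ cdir d0) :
    CSrcScale D.toC :=
  fun k y a j x hx => hD.srcScale k y a j x hx

/-- The constant of the species: `Kp k y = 64·c_dir⁵/r_k` (as for the ray species). [folklore] -/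
def CurData.Kp (D : CurData C E ι α β γ δ) (cdir : ℝ) : ℕ → ι → ℝ := fun k _ => 64 * cdir ^ 5 / D.r k

omit [DecidableEq δ] in
/-- `0 ≤ Kp`. [folklore] -/
theorem kp_nonneg {D : CurData C E ι α β γ δ} {ℓ : ℕ → ℕ → ℝ} {cdir d0 : ℝ} (hD : D.Admissible ℓ cdir d0) (k : ℕ)
    (y : ι) : 0 ≤ D.Kp cdir k y :=
  div_nonneg (mul_nonneg (by norm_num) (pow_nonneg hD.cdir_nonneg 5)) (hD.r_pos k).le

/-- **THE PER-PIECE BOUND OF THE CURVE SPECIES, PROVED ON THE ANALYTIC CLASS** ((I.3.54) ⊕ [II] (1.24) ⊕ (1.25) at FORM level):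
`PieceBoundOnG (analyticClass R) D.toC κ κ₁ d₀ (Kp = 64c_dir⁵/r_k) (ℓ⁵)` — for an analytic family whose creation-step-j slice is
bounded by `e^{−κd}·N`, the piece sourced at (X, re/im) is bounded by `(64c_dir⁵/r_k)·N·(ℓ k j)⁵·e^{−κd(X)}·exp(−⅛(κ₁−1)d_k(Y) +
⅛κ₁d₀ − ½(κ₁−1)·#cubes)`.  Chain: |Re/Im| ≤ ‖·‖; `norm_curPiece_le` (analyticity of `lift H X` on the ball of radius R_X, its
size ≤ 2e^{−κd}N there from the family bound on BOTH copies of X, the curves analytic and INSIDE the ball on their discs);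
`ϱ⁻⁵ ≤ (c_dir·ℓ)⁵`; `B13Sect1Arith.bound_125` under G1. [cite: Balaban1987RG1, (3.54) p.280; Balaban1988RG2Cluster, (1.24)-(1.25) p.7] -/
theorem pieceBoundOnG_cur {D : CurData C E ι α β γ δ} {ℓ : ℕ → ℕ → ℝ} {cdir d0 : ℝ} (hD : D.Admissible ℓ cdir d0)
    (κ : ℝ) : PieceBoundOnG (analyticClass D.R) D.toC κ D.κ₁ d0 (D.Kp cdir) (fun k j => ℓ k j ^ 5) := by
  intro k s y a ha b hb j x hx H hH N hN hbd
  -- letters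
  set X : C.Dom := x.1 with hXdef
  set l := D.cubes k y a b with hl
  set M : ℝ := 2 * (Real.exp (-(κ * C.d X)) * N) with hM
  have hj : C.scale X = j := hD.srcScale k y a j x hx
  -- the size of the complex old term on the ball, from the family bound on both copies of X
  have hMbd : ∀ z ∈ ball (0 : E) (D.R X), ‖lift H X z‖ ≤ M := by
    intro z _
    exact norm_lift_le (hbd z (X, true) hj) (hbd z (X, false) hj)
  have hϱ : 1 < D.ϱ k s y a b x := hD.ϱ_gt k s y a b x
  -- the curve-piece bound (iterated Schwarz on the composite slices + bound_124)
  have hrem := norm_curPiece_le (n := 5) hD.κ₁_ge (hD.r_pos k) (hH X) hMbd hϱ l (D.cur k s y a b x)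
    (fun t ht s' σ' hsσ => hD.cur_an k s y a b x t ht s' σ' hsσ) _ _ (onContour_base D.κ₁ l)
  -- ϱ⁻⁵ ≤ (c_dir ℓ)^5
  have hϱ0 : 0 ≤ (D.ϱ k s y a b x)⁻¹ := inv_nonneg.mpr (zero_le_one.trans hϱ.le)
  have hratio : (D.ϱ k s y a b x)⁻¹ ^ 5 ≤ (cdir * ℓ k j) ^ 5 :=
    pow_le_pow_left₀ hϱ0 (hD.ϱ_inv_le k s y a ha b hb j x hx) 5
  -- (1.25)
  have h125 := B13Sect1Arith.bound_125 (N := (l.length : ℝ)) (dY := D.dY k y) hD.κ₁_ge hD.d0_nonneg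
    (hD.G1 k y a ha b hb)
  have hM0 : 0 ≤ M := by rw [hM]; exact mul_nonneg zero_le_two (mul_nonneg (Real.exp_pos _).le hN)
  have h32M : 0 ≤ 2 ^ 5 * M := mul_nonneg (by norm_num) hM0
  have hcl : 0 ≤ (cdir * ℓ k j) ^ 5 := le_trans (pow_nonneg hϱ0 5) hratio
  have hr0 : 0 < D.r k := hD.r_pos k
  -- assemble
  show |reIm x.2 (curPiece (Real.exp D.κ₁) (D.r k) (D.cubes k y a b) (lift H x.1) 5 (D.cur k s y a b x)
      (fun _ => (0:ℝ)) (fun _ => ((Real.exp D.κ₁ : ℝ) : ℂ)))| ≤ D.Kp cdir k y * N * ℓ k j ^ 5 *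
        Real.exp (-(κ * (doubleCarriers C).d x)) *
          Real.exp (-(1 / 8) * (D.κ₁ - 1) * D.toC.dY k y + (1 / 8) * D.κ₁ * d0 -
            (1 / 2) * (D.κ₁ - 1) * D.toC.vol k y a b)
  have hdx : (doubleCarriers C).d x = C.d X := rfl
  have hdY : D.toC.dY k y = D.dY k y := rfl
  have hvol : D.toC.vol k y a b = (l.length : ℝ) := rfl
  rw [hdx, hdY, hvol, ← hXdef, ← hl]
  calc |reIm x.2 (curPiece (Real.exp D.κ₁) (D.r k) l (lift H X) 5 (D.cur k s y a b x) (fun _ => (0:ℝ))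
          (fun _ => ((Real.exp D.κ₁ : ℝ) : ℂ)))|
        ≤ ‖curPiece (Real.exp D.κ₁) (D.r k) l (lift H X) 5 (D.cur k s y a b x) (fun _ => (0:ℝ))
          (fun _ => ((Real.exp D.κ₁ : ℝ) : ℂ))‖ := abs_reIm_le _ _
    _ ≤ 1 / D.r k * (2 ^ 5 * M * (D.ϱ k s y a b x)⁻¹ ^ 5) * Real.exp (-(D.κ₁ - 1) * l.length) := hrem
    _ ≤ 1 / D.r k * (2 ^ 5 * M * (cdir * ℓ k j) ^ 5) *
          Real.exp (-(1 / 8) * (D.κ₁ - 1) * D.dY k y + (1 / 8) * D.κ₁ * d0 - (1 / 2) * (D.κ₁ - 1) * l.length) := by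
        refine mul_le_mul ?_ h125 (Real.exp_pos _).le ?_
        · exact mul_le_mul_of_nonneg_left (mul_le_mul_of_nonneg_left hratio h32M) (div_pos one_pos hr0).le
        · exact mul_nonneg (div_pos one_pos hr0).le (mul_nonneg h32M hcl)
    _ = D.Kp cdir k y * N * ℓ k j ^ 5 * Real.exp (-(κ * C.d X)) *
          Real.exp (-(1 / 8) * (D.κ₁ - 1) * D.dY k y + (1 / 8) * D.κ₁ * d0 - (1 / 2) * (D.κ₁ - 1) * l.length) := by
        simp only [CurData.Kp, hM]; ring

/-- **LEAF S5 FOR THE CURVE SPECIES ON THE ANALYTIC CLASS (the point of the module)**: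
`ChannelSizeAtStepNN (analyticClass R) (cpieceChannel D.toC) κ (weightOf D.toC.frame κ₁ d₀ O1 Kp) (tauOfG c_Q ℓ′)` from
`CurData.Admissible` (Lemma 4 TYPE, the gain letter, G1, radii) and the level counts of [II] p. 8 with gain ℓ⁵ — part 1's
`channelSizeAtStepNN_cpieceG` fed with `pieceZero_cur`, `pieceLocal_cur`, `csrcScale_cur` and the PROVED `pieceBoundOnG_cur`.
[cite: Balaban1988RG2Cluster, (1.24)-(1.29) pp.7-8, (1.36) p.9] -/
theorem channelSizeAtStepNN_cur {D : CurData C E ι α β γ δ} {ℓ ℓ' : ℕ → ℕ → ℝ} {cdir d0 O1 cQ : ℝ}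
    (hD : D.Admissible ℓ cdir d0) (hℓ : ∀ k j, 0 ≤ ℓ k j) (κ : ℝ)
    (hL : LevelCountsG D.toC.frame κ D.κ₁ O1 cQ (fun k j => ℓ k j ^ 5) ℓ') (hO1 : 0 ≤ O1)
    (hcQℓ : ∀ k j, 0 ≤ cQ * ℓ' k j) :
    ChannelSizeAtStepNN (analyticClass D.R) (cpieceChannel D.toC) κ (weightOf D.toC.frame D.κ₁ d0 O1 (D.Kp cdir))
      (tauOfG cQ ℓ') :=
  channelSizeAtStepNN_cpieceG (pieceZero_cur D) (pieceLocal_cur D) (csrcScale_cur hD) (pieceBoundOnG_cur hD κ) hL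
    (kp_nonneg hD) hO1 (fun k j => pow_nonneg (hℓ k j) 5) hcQℓ

/-- `ChannelLocal` and `ChannelStepSum` for the curve species' channel on ANY class; `AdmRestrict` for the analytic class. [folklore] -/
theorem structureBinders_cur {D : CurData C E ι α β γ δ} {ℓ : ℕ → ℕ → ℝ} {cdir d0 : ℝ} (hD : D.Admissible ℓ cdir d0)
    (Adm : Set (E → (doubleCarriers C).Dom → ℝ)) :
    ChannelLocal Adm (cpieceChannel D.toC) ∧ ChannelStepSum Adm (cpieceChannel D.toC) ∧
      AdmRestrict (C := doubleCarriers C) (analyticClass (E := E) D.R) :=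
  ⟨channelLocal_cpiece (pieceLocal_cur D) (csrcScale_cur hD) Adm,
    channelStepSum_cpiece (pieceZero_cur D) (pieceLocal_cur D) (csrcScale_cur hD) Adm, admRestrict_analyticClass D.R⟩

/-- WHAT S3 STILL NEEDS for the curve species (displayed, honest): `ChannelAdditive` from `PieceAdditiveOn (analyticClass R)
D.toC` — additivity of the curve remainders of analytic slices and of the iterated contour integrals on continuous integrands
(the (w16) module's argument with `dirRem` ↦ `curRem`; crew twin).  Recorded as the implication. [cite: Balaban1988RG2Cluster, (1.23) p.7] -/
theorem channelAdditive_cur_of_pieceAdditive {D : CurData C E ι α β γ δ}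
    (hA : PieceAdditiveOn (analyticClass D.R) D.toC) : ChannelAdditive (analyticClass D.R) (cpieceChannel D.toC) :=
  channelAdditive_cpiece hA

end Species

/-! ## §3 The ray species of parts 2–5 IS the special case γ(σ′) = σ′•A -/

section Ray

variable {C : Carriers} {E : Type} [NormedAddCommGroup E] [NormedSpace ℂ E] {ι α β γ δ : Type}

/-- The ray datum read as a curve datum: `cur … t s σ := (σ′ ↦ σ′ • dir … t s σ)`, slice radius `ϱ := R_X/dirB`. [folklore] -/
def _root_.Summit.QuantumFields.BalabanUV.T4Continuum.NE9Lemma1RemainderSpecies.RemData.toCur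
    (D : RemData C E ι α β γ δ) : CurData C E ι α β γ δ where
  S0 := D.S0
  SY := D.SY
  src := D.src
  Sq := D.Sq
  SX := D.SX
  dY := D.dY
  κ₁ := D.κ₁
  r := D.r
  cubes := D.cubes
  cur := fun k s y a b x t s' σ' τ => τ • D.dir k s y a b x t s' σ'
  R := D.R
  ϱ := fun k s y a b x => D.R x.1 / D.dirB k s y a b x

/-- The ray binders imply the curve binders of the curve reading, under the (harmless, displayed) strict positivity of the
direction bounds: analytic + inside the ball with `ϱ = R_X/dirB` (`mapsTo_ray`), `ϱ > 1 ⇔ dirB < R_X`, and the gain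
`ϱ⁻¹ = dirB/R_X ≤ c_dir·ℓ`. [folklore] -/
theorem _root_.Summit.QuantumFields.BalabanUV.T4Continuum.NE9Lemma1RemainderSpecies.RemData.Admissible.toCur
    {D : RemData C E ι α β γ δ} {ℓ : ℕ → ℕ → ℝ} {cdir d0 : ℝ} (hD : D.Admissible ℓ cdir d0)
    (hpos : ∀ k s y a b x, 0 < D.dirB k s y a b x) : D.toCur.Admissible ℓ cdir d0 where
  κ₁_ge := hD.κ₁_ge
  r_pos := hD.r_pos
  R_pos := hD.R_pos
  cur_an := fun k s y a b x t ht s' σ' hsσ =>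
    ⟨differentiableOn_ray _ _,
      mapsTo_ray (hD.dir_le k s y a b x t ht s' σ' hsσ) (hpos k s y a b x)⟩
  ϱ_gt := fun k s y a b x => by
    show 1 < D.R x.1 / D.dirB k s y a b x
    rw [lt_div_iff₀ (hpos k s y a b x), one_mul]
    exact hD.dirB_lt k s y a b x
  ϱ_inv_le := fun k s y a ha b hb j x hx => by
    show (D.R x.1 / D.dirB k s y a b x)⁻¹ ≤ cdir * ℓ k j
    rw [inv_div, div_le_iff₀ (hD.R_pos x.1)]
    exact hD.dirB_le k s y a ha b hb j x hx
  srcScale := hD.srcScale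
  G1 := hD.G1
  d0_nonneg := hD.d0_nonneg
  cdir_nonneg := hD.cdir_nonneg

variable [DecidableEq δ]

/-- **THE RAY SPECIES' PIECE FORM IS LITERALLY THE CURVE SPECIES' PIECE FORM OF ITS CURVE READING** (definitional): every landed
statement about `RemData.toC` (parts 2–3; crew (w16), A3-REM, MP-REM, E5′-REM) is a statement about this sub-case. [folklore] -/
theorem _root_.Summit.QuantumFields.BalabanUV.T4Continuum.NE9Lemma1RemainderSpecies.RemData.toCur_toC
    (D : RemData C E ι α β γ δ) : D.toCur.toC = D.toC := rfl

/-- Hence part 2's per-piece bound is recovered from the curve bound on the ray reading (consistency check, by name). [folklore] -/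
example {D : RemData C E ι α β γ δ} {ℓ : ℕ → ℕ → ℝ} {cdir d0 : ℝ} (hD : D.Admissible ℓ cdir d0)
    (hpos : ∀ k s y a b x, 0 < D.dirB k s y a b x) (κ : ℝ) :
    PieceBoundOnG (analyticClass D.R) D.toC κ D.κ₁ d0 (D.toCur.Kp cdir) (fun k j => ℓ k j ^ 5) := by
  rw [← D.toCur_toC]
  exact pieceBoundOnG_cur (hD.toCur hpos) κ

end Ray

end Summit.QuantumFields.BalabanUV.T4Continuum.NE9Lemma1CurveSpecies
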